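import Literature.Analysis.FluidPDE.NSLerayHopf
import Literature.Analysis.FluidPDE.SpaceTimeRescaling
import Literature.Analysis.FluidPDE.KatoViscosityScaling
import Literature.Analysis.FluidPDE.KatoLocalCovariance
import Literature.Analysis.FunctionSpaces.SobolevDomainNormProofs
import HarnessLib

/-!
# Albritton–Brué–Colombo non-uniqueness: the viscosity scaling (unit viscosity ⟹ every `ν > 0`)

Analysis/FluidPDE file serving the decomposition of the named fact **ns.S20**
`Literature.Analysis.FluidPDE.albritton_brue_colombo` (`NSLerayHopf.lean`; Albritton–Brué–Colombo,
Ann. of Math. 196 (2022) = arXiv:2112.03116). The printed theorem (arXiv numbering: Def. 1.1,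
**Thm. 1.2** "Non-uniqueness", Thm. 1.3 "Non-uniqueness, refined") is stated for the system
`∂ₜu + u·∇u − Δu + ∇p = f`, i.e. at viscosity `ν = 1`:

> There exist `T > 0`, `f ∈ L¹_t L²_x(ℝ³ × (0,T))`, and two distinct suitable Leray–Hopf solutions
> `u`, `ū` to the Navier–Stokes equations on `ℝ³ × (0,T)` with body force `f` and initial
> condition `u₀ ≡ 0`.

The tree's `albritton_brue_colombo` asserts this for *every* `ν > 0` ("the general case follows by
the Navier–Stokes scaling"). This file

* vendors the printed unit-viscosity statement as the named fact `albritton_brue_colombo_unit`,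
  **faithfully to Def. 1.1**: the force is *jointly measurable on `(0, T) × ℝ³`*
  (`AEStronglyMeasurable (uncurry f) (volume.restrict (Ioo 0 T ×ˢ univ))`, the clause
  `IsWeakNSSolutionOn` imposes on the velocity and `hopf_existence_torus` on its force) **and**
  in the slice-wise mixed class `MemLqLp 1 2 f (Ioo 0 T)` — together the tree's reading of the
  Bochner class `f ∈ L¹_t L²_x(ℝ³ × (0,T))` —, two `IsLerayHopfOn T 1 f 0` solutions, distinct at
  some `t ∈ (0, T)`;
* **proves** the covariance of the accepted notions `IsWeakNSSolutionOn`, `MemLqLp`,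
  `IsLerayHopfOn` under the viscosity scaling `u ↦ c u(c ·, ·)`, `f ↦ c² f(c ·, ·)`,
  `u₀ ↦ c u₀`, `ν ↦ c ν`, `T ↦ T / c` (`c > 0`; in the tree's notation
  `timeRescale c c u`, `timeRescale c (c ^ 2) f`): every clause of the weak formulation picks up
  the common factor `c` after the substitution `t = c s` (test fields are pulled back along
  `s ↦ c⁻¹ s`, `SpaceTimeRescaling.lean`), the energy inequalities pick up the common factor
  `c²`, and weak/strong `L²` continuity is composed with `s ↦ c s`
  (`IsWeakNSSolutionOn.viscosityRescale`, `MemLqLp.viscosityRescale`,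
  `IsLerayHopfOn.viscosityRescale`);
* **proves** the reduction `albritton_brue_colombo_of_unit : albritton_brue_colombo_unit →
  albritton_brue_colombo` (`c = ν`, forgetting the measurability of the force),
  `albritton_brue_colombo_of_viscosity` (the tree fact at any one viscosity `ν₀ > 0` gives it at
  every `ν > 0`, `c = ν/ν₀`), and the equivalence
  `albritton_brue_colombo_unit_iff_forall_viscosity` (the faithful unit-viscosity statement is
  equivalent to its every-viscosity form, written out in full — the statement that
  `albritton_brue_colombo` renders without the measurability clause).

**Restatement (2026-08-15, review of the ns.S20 decomposition; statement of
`albritton_brue_colombo_unit` CHANGED, strengthened).** The unit-viscosity fact was first vendored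
(p25167) as the literal `ν = 1` instance of `albritton_brue_colombo`, i.e. with the force
quantified only through `MemLqLp 1 2 f (Ioo 0 T)`, which by design sees the slices `f t` and no
measurability of `t ↦ f t`; the two facts were then interderivable
(`albritton_brue_colombo_iff_unit`, withdrawn). That rendering is provable by a degenerate
non-measurable force — `ABCVacuity.unit_rendering_is_vacuous` / `rendering_is_vacuous`
(`NSLerayHopfABCVacuity.lean`, whose statements spell the *retired* bodies out in full): the force
enters `IsLerayHopfOn` only through Bochner integrals in time, junk `0` without measurability — and
is therefore weaker than the printed theorem, whose `f ∈ L¹_t L²_x` is an element of a Bochner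
space. Following the tree's precedent for this family of defects (`WeakSolution.lean`, "Retired /
corrected named facts") the unit-viscosity fact now carries the measurability clause; with it
every Bochner integral in `IsWeakNSSolutionOn` / `IsLerayHopfOn` of a Leray–Hopf pair `(u, f)` is
an honest integral (jointly measurable integrands, time integrands bounded by
`C (1 + ‖f t‖₂) ∈ L¹(0,T)`), and the degenerate example collapses (there `u ≡ 0`, which now
forces `f t` to be a gradient for a.e. `t`, `L²`-orthogonal to the divergence-free slices of the
second solution `v`, whose energy inequality from the zero datum then gives `v = 0`). The every-viscosity tree fact `albritton_brue_colombo`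
(`NSLerayHopf.lean`) is untouched here and is now strictly weaker than (implied by, not equivalent
to) `albritton_brue_colombo_unit`; its faithful form is the right-hand side of
`albritton_brue_colombo_unit_iff_forall_viscosity`.

What is NOT here: the proof of Thm. 1.2 itself (Thm. 1.3 ⟸ §2 Vishik's unstable vortex,
truncated (Prop. 2.6-type) and lifted to an axisymmetric vortex ring, §3 Thm. 3.1 / Cor. 3.2
spectral perturbation from Euler to the self-similar Navier–Stokes operator, §4 Thm. 4.1 nonlinear
instability), which stays the named fact `albritton_brue_colombo_unit` — an undecomposed root:
none of these steps is a separately citable result of moderate size over Mathlib (no spectral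
theory of unbounded non-self-adjoint operators, no `L_ss` semigroup), while everything DOWNSTREAM
of Thm. 1.3 is proved in `NSLerayHopfABCAssembly.lean` / `NSLerayHopfABCTrajectory.lean`
(`albritton_brue_colombo_unit_of_similarityProfiles` delivers exactly the faithful statement).

## Mathlib / tree search

Tree: the parabolic scaling of Leray–Hopf solutions at *fixed* viscosity is the named fact
`IsLerayHopfOn.nsRescale` (`SelfSimilar.lean`); viscosity scalings are proved for classical
solutions (`IsClassicalNSSolutionOn.viscosityRescale`, `NSViscosityRescaling.lean`), mild/Kato
solutions (`IsMildNSSolutionOn.timeRescale`, `KatoViscosityScaling.lean`), local Leray solutions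
(`IsLocalLeraySolutionOn.viscosityRescale`, `LocalLeraySlabViscosityScaling.lean`) and
distributional solutions (`IsDistributionalNSSolutionOn.stRescale`, `SpaceTimeRescaling.lean`), but
not for `IsWeakNSSolutionOn` / `IsLerayHopfOn` (`lean search 'IsLerayHopfOn\..*scal|IsWeakNSSolutionOn\..*scal'`:
none). Used: `stPull`, `stAffine`, `IsSpaceTimeTestOn.stPull_symm`, `timeDeriv_stPull`,
`convect_stPull`, `laplacian_stPull`, `divergence_stPull`, `setIntegral_Ioo_comp_time_affine`,
`ae_restrict_Ioo_comp_time_affine`, `setLIntegral_enorm_pow_stRescale`, `frobeniusNormSq_smul`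
(`SpaceTimeRescaling`), `aestronglyMeasurable_comp_stAffine_Ioo` (`KatoLocalCovariance`),
`IsWeaklyDivFree.const_smul`, `timeRescale`, `lintegral_comp_mul_left_eq`,
`lintegral_enorm_sq_const_smul` (`KatoViscosityScaling` / `NSViscosityRescaling`),
`HasWeakFDerivOn.const_smul` (`SobolevDomainNormProofs`); Mathlib `Real.map_volume_mul_left`,
`MeasurableEmbedding.restrict_map`, `eLpNorm_smul_measure_of_ne_zero`,
`intervalIntegral.smul_integral_comp_mul_left`, `eLpNorm_const_smul`. The proved scaling lemmas
carry the tree's citation for the viscosity normalisation (Tao 2013, footnote 3, as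
`IsClassicalNSSolutionOn.viscosityRescale`); Albritton–Brué–Colombo's own (1.5)–(1.6) is the
parabolic scaling at fixed viscosity.

## References

* D. Albritton, E. Brué, M. Colombo, *Non-uniqueness of Leray solutions of the forced
  Navier–Stokes equations*, Ann. of Math. 196 (2022) 415–455 = arXiv:2112.03116, Def. 1.1,
  Thm. 1.2, Thm. 1.3, §1.1 (1.5)–(1.6) (scaling symmetry; footnote 1: the viscosity is treated as
  dimensionless). [AlbrittonBrueColombo2022]
* W. Rusin, V. Šverák, J. Funct. Anal. 260 (2011) = arXiv:0911.0500, §1 p. 3 (normalisation of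
  the viscosity). [RusinSverak2011]
* T. Tao, *Localisation and compactness properties of the Navier–Stokes global regularity
  problem*, Anal. PDE 6 (2013) = arXiv:1108.1165, footnote 3 (viscosity rescaling). [Tao2011]
-/

noncomputable section

open MeasureTheory TopologicalSpace Set Function Filter
open _root_.Topology
open scoped InnerProductSpace RealInnerProductSpace ENNReal NNReal Laplacian

namespace Literature.Analysis.FluidPDE

/-! ### One-variable bookkeeping for the substitution `t = c s` -/

section Time

/-- `s ↦ c s` maps `(0, T/c)` onto `(0, T)`: membership form (`c > 0`). [folklore] -/
theorem mul_mem_Ioo_zero_iff_mem_Ioo_div {c : ℝ} (hc : 0 < c) (T s : ℝ) :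
    c * s ∈ Ioo 0 T ↔ s ∈ Ioo 0 (T / c) := by
  rw [mem_Ioo, mem_Ioo, lt_div_iff₀ hc, mul_comm c s]
  exact ⟨fun h => ⟨pos_of_mul_pos_left h.1 hc.le, h.2⟩, fun h => ⟨mul_pos h.1 hc, h.2⟩⟩

/-- `s ↦ c s` maps `[0, T/c]` into `[0, T]` (`c > 0`). [folklore] -/
theorem mul_mem_Icc_zero_of_mem_Icc_div {c : ℝ} (hc : 0 < c) {T s : ℝ} (hs : s ∈ Icc 0 (T / c)) :
    c * s ∈ Icc 0 T :=
  ⟨mul_nonneg hc.le hs.1, by rw [mul_comm]; exact (le_div_iff₀ hc).1 hs.2⟩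

/-- `s ↦ c s` maps `(0, T/c]` into `(0, T]` (`c > 0`). [folklore] -/
theorem mapsTo_mul_Ioc_div {c : ℝ} (hc : 0 < c) (T : ℝ) :
    MapsTo (fun s => c * s) (Ioc 0 (T / c)) (Ioc 0 T) := by
  intro s hs
  refine ⟨mul_pos hc hs.1, ?_⟩
  show c * s ≤ T
  rw [mul_comm]
  exact (le_div_iff₀ hc).1 hs.2

/-- `c (T / c) = T`. [folklore] -/
theorem mul_div_cancel_pos {c : ℝ} (hc : 0 < c) (T : ℝ) : c * (T / c) = T := by
  rw [← mul_div_assoc, mul_div_cancel_left₀ _ hc.ne']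

/-- `s ↦ c s` tends to `0⁺` as `s → 0⁺` (`c > 0`). [folklore] -/
theorem tendsto_mul_left_nhdsGT_zero {c : ℝ} (hc : 0 < c) :
    Tendsto (fun s : ℝ => c * s) (𝓝[>] (0 : ℝ)) (𝓝[>] (0 : ℝ)) := by
  have h1 : Tendsto (fun s : ℝ => c * s) (𝓝 0) (𝓝 (c * 0)) := (continuous_const_mul c).tendsto 0
  rw [mul_zero] at h1
  refine tendsto_nhdsWithin_of_tendsto_nhds_of_eventually_within _
    (h1.mono_left nhdsWithin_le_nhds) ?_
  filter_upwards [self_mem_nhdsWithin] with s hs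
  exact mul_pos hc hs

/-- Transport of a.e.-in-time statements along `s ↦ c s` (`c > 0`): if `P t` for a.e.
`t ∈ (c a, c b)` then `P (c s)` for a.e. `s ∈ (a, b)`. [folklore] -/
theorem ae_restrict_Ioo_comp_mul_left {c : ℝ} (hc : 0 < c) (a b : ℝ) {P : ℝ → Prop}
    (h : ∀ᵐ t ∂(volume.restrict (Ioo (c * a) (c * b))), P t) :
    ∀ᵐ s ∂(volume.restrict (Ioo a b)), P (c * s) := by
  have h' : ∀ᵐ t ∂(volume.restrict (Ioo (0 + c * a) (0 + c * b))), P t := by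
    simpa only [zero_add] using h
  simpa only [zero_add] using ae_restrict_Ioo_comp_time_affine hc 0 a b h'

/-- The same from `(0, T)` to `(0, T / c)`. [folklore] -/
theorem ae_restrict_Ioo_div_comp_mul_left {c : ℝ} (hc : 0 < c) (T : ℝ) {P : ℝ → Prop}
    (h : ∀ᵐ t ∂(volume.restrict (Ioo 0 T)), P t) :
    ∀ᵐ s ∂(volume.restrict (Ioo 0 (T / c))), P (c * s) := by
  refine ae_restrict_Ioo_comp_mul_left hc 0 (T / c) ?_
  rwa [mul_zero, mul_div_cancel_pos hc]

/-- Change of variables `t = c s` in lower Lebesgue integrals over intervals: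
`∫_{(a,b)} G(c s) ds = c⁻¹ ∫_{(ca, cb)} G(t) dt` (`c > 0`, no measurability needed). [folklore] -/
theorem setLIntegral_Ioo_comp_const_mul (G : ℝ → ℝ≥0∞) {c : ℝ} (hc : 0 < c) (a b : ℝ) :
    ∫⁻ s in Ioo a b, G (c * s) = ENNReal.ofReal c⁻¹ * ∫⁻ t in Ioo (c * a) (c * b), G t := by
  rw [← lintegral_indicator measurableSet_Ioo, ← lintegral_indicator measurableSet_Ioo]
  have hind : (fun s => (Ioo a b).indicator (fun s => G (c * s)) s) =
      fun s => (Ioo (c * a) (c * b)).indicator G (c * s) := by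
    funext s
    by_cases hs : s ∈ Ioo a b
    · have hcs : c * s ∈ Ioo (c * a) (c * b) :=
        ⟨mul_lt_mul_of_pos_left hs.1 hc, mul_lt_mul_of_pos_left hs.2 hc⟩
      rw [indicator_of_mem hs, indicator_of_mem hcs]
    · rw [indicator_of_notMem hs, indicator_of_notMem]
      rintro ⟨h1, h2⟩
      exact hs ⟨lt_of_mul_lt_mul_left h1 hc.le, lt_of_mul_lt_mul_left h2 hc.le⟩
  rw [hind, lintegral_comp_mul_left_eq _ hc.ne', abs_of_pos (inv_pos.2 hc)]

/-- Change of variables `t = c s` in Bochner integrals over intervals: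
`∫_{(a,b)} g(c s) ds = c⁻¹ ∫_{(ca, cb)} g(t) dt` (`c > 0`). [folklore] -/
theorem setIntegral_Ioo_comp_const_mul {G : Type*} [NormedAddCommGroup G] [NormedSpace ℝ G]
    (g : ℝ → G) {c : ℝ} (hc : 0 < c) (a b : ℝ) :
    ∫ s in Ioo a b, g (c * s) = c⁻¹ • ∫ t in Ioo (c * a) (c * b), g t := by
  simpa only [zero_add] using setIntegral_Ioo_comp_time_affine hc 0 a b g

/-- The push-forward of Lebesgue measure on `(a, b)` under `s ↦ c s` is `c⁻¹ •` Lebesgue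
measure on `(ca, cb)` (`c > 0`). [folklore] -/
theorem map_mul_left_volume_restrict_Ioo {c : ℝ} (hc : 0 < c) (a b : ℝ) :
    (volume.restrict (Ioo a b)).map (fun s => c * s) =
      ENNReal.ofReal c⁻¹ • volume.restrict (Ioo (c * a) (c * b)) := by
  have hme : MeasurableEmbedding (fun s : ℝ => c * s) :=
    (Homeomorph.mulLeft₀ c hc.ne').measurableEmbedding
  have hpre : (fun s : ℝ => c * s) ⁻¹' Ioo (c * a) (c * b) = Ioo a b := by
    ext s
    rw [mem_preimage, mem_Ioo, mem_Ioo]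
    constructor
    · rintro ⟨h1, h2⟩
      exact ⟨lt_of_mul_lt_mul_left h1 hc.le, lt_of_mul_lt_mul_left h2 hc.le⟩
    · rintro ⟨h1, h2⟩
      exact ⟨mul_lt_mul_of_pos_left h1 hc, mul_lt_mul_of_pos_left h2 hc⟩
  rw [← hpre, ← hme.restrict_map, Real.map_volume_mul_left hc.ne', Measure.restrict_smul,
    abs_of_pos (inv_pos.2 hc)]

end Time

/-! ### The viscosity scaling of weak solutions, mixed norms and Leray–Hopf solutions -/

section Scaling

variable {E : Type*} [NormedAddCommGroup E] [InnerProductSpace ℝ E] [FiniteDimensional ℝ E]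
  [MeasurableSpace E] [BorelSpace E]

omit [FiniteDimensional ℝ E] [MeasurableSpace E] [BorelSpace E] in
/-- The time dilation `Φ(s, y) = (c s, y)` pulls the open slab `(-∞, T) × E` back to
`(-∞, T/c) × E` (`c > 0`). [folklore] -/
theorem stPreimage_slab_Iio {c : ℝ} (hc : 0 < c) (T : ℝ) :
    stPreimage c 1 0 (0 : E) (slab E (Iio T) isOpen_Iio) = slab E (Iio (T / c)) isOpen_Iio := by
  ext z
  simp only [coe_stPreimage, mem_preimage, SetLike.mem_coe, mem_slab, stAffine_fst, zero_add,
    mem_Iio]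
  rw [lt_div_iff₀ hc, mul_comm]

omit [FiniteDimensional ℝ E] [MeasurableSpace E] [BorelSpace E] in
/-- `Φ⁻¹((0, T) × K) = (0, T/c) × K` for the time dilation `Φ(s, y) = (c s, y)`. [folklore] -/
theorem stAffine_preimage_Ioo_prod_of_pos {c : ℝ} (hc : 0 < c) (T : ℝ) (K : Set E) :
    stAffine c 1 0 (0 : E) ⁻¹' (Ioo 0 T ×ˢ K) = Ioo 0 (T / c) ×ˢ K := by
  ext ⟨s, y⟩
  simp only [mem_preimage, stAffine_apply, zero_add, one_smul, mem_prod,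
    mul_mem_Ioo_zero_iff_mem_Ioo_div hc]

omit [FiniteDimensional ℝ E] [MeasurableSpace E] [BorelSpace E] in
/-- Pointwise form: `timeRescale c a u s y = (a • stPull c 1 0 0 u) s y`. [folklore] -/
theorem timeRescale_eq_smul_stPull {F : Type*} [NormedAddCommGroup F] [NormedSpace ℝ F]
    (c a : ℝ) (u : ℝ → E → F) : timeRescale c a u = a • stPull c 1 0 (0 : E) u := by
  funext s y
  rw [timeRescale_apply, smul_stPull_apply, zero_add, zero_add, one_smul]

/-- **Viscosity scaling of weak solutions.** If `u` is a weak solution on `E × [0, T)` with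
viscosity `ν`, force `f` and datum `u₀`, then for `c > 0` the field `s ↦ c u(c s)` is a weak
solution on `[0, T/c)` with viscosity `c ν`, force `s ↦ c² f(c s)` and datum `c u₀`: against a
divergence-free test field `ψ` on `(-∞, T/c) × E` one tests `u` with `ψ(c⁻¹ ·, ·)`; after the
substitution `t = c s` every term of the weak identity is `c` times the corresponding term for
`u` (the viscosity normalisation of Tao 2013, footnote 3, and Rusin–Šverák 2011, §1 p. 3, which
print the unit-viscosity system; tree precedent `IsClassicalNSSolutionOn.viscosityRescale`).
[cite: Tao2011, footnote 3] -/
theorem IsWeakNSSolutionOn.viscosityRescale {T ν : ℝ} {f u : ℝ → E → E} {u₀ : E → E}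
    (h : IsWeakNSSolutionOn T ν f u₀ u) {c : ℝ} (hc : 0 < c) :
    IsWeakNSSolutionOn (T / c) (c * ν) (timeRescale c (c ^ 2) f) (c • u₀) (timeRescale c c u) := by
  obtain ⟨hmeas, hloc, hdiv, hweak⟩ := h
  refine ⟨?_, fun K hK => ?_, ?_, fun ψ hψ hψdiv => ?_⟩
  · -- measurability on the slab `(0, T/c) × E`
    have h1 := aestronglyMeasurable_comp_stAffine_Ioo hc one_pos (0 : E) hmeas
    have h2 : uncurry (timeRescale c c u) = fun z => c • (uncurry u ∘ stAffine c 1 0 (0 : E)) z := by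
      funext z
      obtain ⟨s, y⟩ := z
      simp [stAffine]
    rw [h2]
    exact h1.const_smul c
  · -- local square integrability up to the time boundary
    have h1 := setLIntegral_enorm_pow_stRescale hc one_pos 0 (0 : E) c u (Ioo 0 T ×ˢ K) 2
    rw [stAffine_preimage_Ioo_prod_of_pos hc, one_pow, mul_one, ← timeRescale_eq_smul_stPull] at h1
    calc ∫⁻ z in Ioo 0 (T / c) ×ˢ K, ‖uncurry (timeRescale c c u) z‖ₑ ^ 2
        = ‖c‖ₑ ^ 2 * ENNReal.ofReal c⁻¹ * ∫⁻ z in Ioo 0 T ×ˢ K, ‖u z.1 z.2‖ₑ ^ 2 := h1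
      _ < ∞ := ENNReal.mul_lt_top (ENNReal.mul_lt_top (ENNReal.pow_lt_top enorm_lt_top)
          ENNReal.ofReal_lt_top) (hloc K hK)
  · -- weak divergence-freeness of a.e. slice
    filter_upwards [ae_restrict_Ioo_div_comp_mul_left hc T hdiv] with s hs
    rw [timeRescale_slice]
    exact hs.const_smul c
  · -- the weak identity: test `u` with `ψ(c⁻¹ ·, ·)`
    rw [← stPreimage_slab_Iio hc] at hψ
    set ψ' := stPull c⁻¹ (1 : ℝ)⁻¹ (-(c⁻¹ * 0)) (-((1 : ℝ)⁻¹ • (0 : E))) ψ with hψ'_def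
    have hψ'Q : IsSpaceTimeTestOn (slab E (Iio T) isOpen_Iio) ψ' := hψ.stPull_symm hc.ne' one_ne_zero
    have hrepr : ψ = stPull c 1 0 0 ψ' := (stPull_stPull_symm hc.ne' one_ne_zero 0 0 ψ).symm
    have hdiv' : ∀ t, VectorCalculus.IsDivFree (ψ' t) := by
      intro t x
      have h0 := hψdiv (-(c⁻¹ * 0) + c⁻¹ * t) (-((1 : ℝ)⁻¹ • (0 : E)) + (1 : ℝ)⁻¹ • x)
      rw [hψ'_def, divergence_stPull, h0, mul_zero]
    have hid := hweak ψ' hψ'Q hdiv'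
    set I : ℝ → E → ℝ := fun t x => ⟪u t x, timeDeriv ψ' t x⟫ + ⟪u t x, convect (u t) (ψ' t) x⟫ +
      ν * ⟪u t x, Δ (ψ' t) x⟫ + ⟪f t x, ψ' t x⟫ with hI
    have key : ∀ s y, ⟪timeRescale c c u s y, timeDeriv ψ s y⟫ +
        ⟪timeRescale c c u s y, convect (timeRescale c c u s) (ψ s) y⟫ +
        c * ν * ⟪timeRescale c c u s y, Δ (ψ s) y⟫ + ⟪timeRescale c (c ^ 2) f s y, ψ s y⟫ =
        c ^ 2 * I (c * s) y := by
      intro s y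
      conv_lhs => rw [hrepr]
      rw [timeDeriv_stPull, convect_stPull,
        laplacian_stPull _ _ _ _ _ _ _ (hψ'Q.contDiff_slice_two _), stPull_apply, hI]
      simp only [zero_add, one_smul, one_pow, timeRescale_apply, map_smul, real_inner_smul_left,
        real_inner_smul_right, convect_apply]
      ring
    have hA : ∫ s in Ioo 0 (T / c), ∫ y, (⟪timeRescale c c u s y, timeDeriv ψ s y⟫ +
        ⟪timeRescale c c u s y, convect (timeRescale c c u s) (ψ s) y⟫ +
        c * ν * ⟪timeRescale c c u s y, Δ (ψ s) y⟫ + ⟪timeRescale c (c ^ 2) f s y, ψ s y⟫) =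
        c * ∫ t in Ioo 0 T, ∫ x, I t x := by
      simp_rw [key, integral_const_mul]
      have h3 := setIntegral_Ioo_comp_const_mul (fun t => ∫ x, I t x) hc 0 (T / c)
      beta_reduce at h3
      rw [mul_zero, mul_div_cancel_pos hc] at h3
      rw [h3, smul_eq_mul, ← mul_assoc, sq, mul_assoc c c, mul_inv_cancel₀ hc.ne', mul_one]
    have hB : ∫ y, ⟪(c • u₀) y, ψ 0 y⟫ = c * ∫ x, ⟪u₀ x, ψ' 0 x⟫ := by
      rw [← integral_const_mul]
      refine integral_congr_ae (Eventually.of_forall fun y => ?_)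
      rw [hrepr]
      simp only [Pi.smul_apply, stPull_apply, mul_zero, zero_add, one_smul, real_inner_smul_left]
    rw [hA, hB, ← mul_add, hid, mul_zero]

/-- **Viscosity scaling of the mixed norms.** If `f ∈ L^q(0, T; L^p)` then
`s ↦ a f(c s) ∈ L^q(0, T/c; L^p)` for `c > 0` and any amplitude `a` (slice-wise
`‖a f(c s)‖_p = |a| ‖f(c s)‖_p`, and `s ↦ c s` pushes Lebesgue measure on `(0, T/c)` to `c⁻¹ •`
Lebesgue measure on `(0, T)`). [folklore] -/
theorem MemLqLp.viscosityRescale {F : Type*} [NormedAddCommGroup F] [NormedSpace ℝ F]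
    {q p : ℝ≥0∞} {T : ℝ} {f : ℝ → E → F} (h : MemLqLp q p f (Ioo 0 T)) {c : ℝ} (hc : 0 < c)
    (a : ℝ) : MemLqLp q p (timeRescale c a f) (Ioo 0 (T / c)) := by
  refine ⟨?_, ?_⟩
  · filter_upwards [ae_restrict_Ioo_div_comp_mul_left hc T h.1] with s hs
    rw [timeRescale_slice]
    exact hs.const_smul a
  · have hme : MeasurableEmbedding (fun s : ℝ => c * s) :=
      (Homeomorph.mulLeft₀ c hc.ne').measurableEmbedding
    have hmap := map_mul_left_volume_restrict_Ioo hc 0 (T / c)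
    rw [mul_zero, mul_div_cancel_pos hc] at hmap
    have e1 : (fun s => (eLpNorm (timeRescale c a f s) p volume).toReal) =
        ‖a‖ • ((fun t => (eLpNorm (f t) p volume).toReal) ∘ fun s => c * s) := by
      funext s
      rw [timeRescale_slice, show (fun x => a • f (c * s) x) = a • f (c * s) from rfl,
        eLpNorm_const_smul, Pi.smul_apply, comp_apply, smul_eq_mul, ENNReal.toReal_mul,
        toReal_enorm]
    rw [eLqLpNorm, e1, eLpNorm_const_smul, ← hme.eLpNorm_map_measure, hmap,
      eLpNorm_smul_measure_of_ne_zero (ENNReal.ofReal_pos.2 (inv_pos.2 hc)).ne', smul_eq_mul]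
    exact ENNReal.mul_lt_top enorm_lt_top (ENNReal.mul_lt_top
      (ENNReal.rpow_lt_top_of_nonneg (by positivity) ENNReal.ofReal_ne_top) h.2)

/-- Kinetic energy of the rescaled slice: `E(a w) = a² E(w)`. [folklore] -/
theorem kineticEnergy_const_smul (a : ℝ) (w : E → E) :
    VectorCalculus.kineticEnergy (fun x => a • w x) = a ^ 2 * VectorCalculus.kineticEnergy w := by
  simp only [VectorCalculus.kineticEnergy, norm_smul, mul_pow, Real.norm_eq_abs, sq_abs,
    integral_const_mul]
  ring

/-- The dissipation of the rescaled weak gradient `s ↦ c G(c s)` over `(a, b)`: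
`∫_{(a,b)} ∫ |c G(c s)|² = c² c⁻¹ ∫_{(ca,cb)} ∫ |G|²`. [folklore] -/
theorem setLIntegral_frobeniusNormSq_timeRescale {c : ℝ} (hc : 0 < c) (G : ℝ → E → E →L[ℝ] E)
    (a b : ℝ) :
    ∫⁻ τ in Ioo a b, ∫⁻ x, ENNReal.ofReal (frobeniusNormSq (timeRescale c c G τ x)) =
      ENNReal.ofReal (c ^ 2) * ENNReal.ofReal c⁻¹ *
        ∫⁻ τ in Ioo (c * a) (c * b), ∫⁻ x, ENNReal.ofReal (frobeniusNormSq (G τ x)) := by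
  have e1 : ∀ τ, ∫⁻ x, ENNReal.ofReal (frobeniusNormSq (timeRescale c c G τ x)) =
      ENNReal.ofReal (c ^ 2) *
        (fun t => ∫⁻ x, ENNReal.ofReal (frobeniusNormSq (G t x))) (c * τ) := by
    intro τ
    rw [← lintegral_const_mul' _ _ ENNReal.ofReal_ne_top]
    refine lintegral_congr fun x => ?_
    rw [timeRescale_apply, frobeniusNormSq_smul, ENNReal.ofReal_mul (sq_nonneg _)]
  have h3 := setLIntegral_Ioo_comp_const_mul
    (fun t => ∫⁻ x, ENNReal.ofReal (frobeniusNormSq (G t x))) hc a b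
  simp_rw [e1]
  rw [lintegral_const_mul' _ _ ENNReal.ofReal_ne_top, h3, mul_assoc]

/-- The forcing term of the rescaled pair over `(a, b)`:
`∫ₐᵇ ∫ ⟪c² f(c s), c u(c s)⟫ ds = c² ∫_{ca}^{cb} ∫ ⟪f, u⟫`. [folklore] -/
theorem intervalIntegral_forcing_timeRescale (c : ℝ) (f u : ℝ → E → E) (a b : ℝ) :
    ∫ τ in a..b, ∫ x, ⟪timeRescale c (c ^ 2) f τ x, timeRescale c c u τ x⟫ =
      c ^ 2 * ∫ τ in (c * a)..(c * b), ∫ x, ⟪f τ x, u τ x⟫ := by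
  have e1 : ∀ τ, ∫ x, ⟪timeRescale c (c ^ 2) f τ x, timeRescale c c u τ x⟫ =
      c ^ 3 * (fun t => ∫ x, ⟪f t x, u t x⟫) (c * τ) := by
    intro τ
    rw [← integral_const_mul]
    refine integral_congr_ae (Eventually.of_forall fun x => ?_)
    simp only [timeRescale_apply, real_inner_smul_left, real_inner_smul_right]
    ring
  simp_rw [e1]
  rw [intervalIntegral.integral_const_mul, ← intervalIntegral.smul_integral_comp_mul_left _ c,
    smul_eq_mul]
  ring

/-- **The energy inequality under the viscosity scaling**: if
`E(u(cb)) + ν ∫_{(ca,cb)} ∫|G|² ≤ A + ∫_{ca}^{cb} ∫⟪f, u⟫` then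
`E(c u(cb)) + (cν) ∫_{(a,b)} ∫|c G(c ·)|² ≤ c² A + ∫ₐᵇ ∫⟪c² f(c ·), c u(c ·)⟫` (both sides are
`c²` times the original ones). [folklore] -/
theorem energyIneq_timeRescale {c ν : ℝ} (hc : 0 < c) {f u : ℝ → E → E}
    {G : ℝ → E → E →L[ℝ] E} {a b A : ℝ}
    (h : VectorCalculus.kineticEnergy (u (c * b)) +
      ν * (∫⁻ τ in Ioo (c * a) (c * b), ∫⁻ x, ENNReal.ofReal (frobeniusNormSq (G τ x))).toReal ≤
      A + ∫ τ in (c * a)..(c * b), ∫ x, ⟪f τ x, u τ x⟫) :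
    VectorCalculus.kineticEnergy (timeRescale c c u b) +
      c * ν * (∫⁻ τ in Ioo a b, ∫⁻ x,
        ENNReal.ofReal (frobeniusNormSq (timeRescale c c G τ x))).toReal ≤
      c ^ 2 * A + ∫ τ in a..b, ∫ x, ⟪timeRescale c (c ^ 2) f τ x, timeRescale c c u τ x⟫ := by
  rw [show timeRescale c c u b = fun x => c • u (c * b) x from rfl, kineticEnergy_const_smul,
    setLIntegral_frobeniusNormSq_timeRescale hc, intervalIntegral_forcing_timeRescale c,
    ENNReal.toReal_mul, ENNReal.toReal_mul,
    ENNReal.toReal_ofReal (sq_nonneg c), ENNReal.toReal_ofReal (inv_nonneg.2 hc.le)]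
  have h2 := mul_le_mul_of_nonneg_left h (sq_nonneg c)
  have e : c * ν * (c ^ 2 * c⁻¹ *
      (∫⁻ τ in Ioo (c * a) (c * b), ∫⁻ x, ENNReal.ofReal (frobeniusNormSq (G τ x))).toReal) =
      c ^ 2 * (ν * (∫⁻ τ in Ioo (c * a) (c * b), ∫⁻ x,
        ENNReal.ofReal (frobeniusNormSq (G τ x))).toReal) := by
    rw [show c ^ 2 * c⁻¹ = c by rw [sq, mul_assoc, mul_inv_cancel₀ hc.ne', mul_one]]
    ring
  rw [e, ← mul_add, ← mul_add]
  exact h2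

/-- **Viscosity scaling of Leray–Hopf weak solutions** (the viscosity normalisation of Tao 2013,
footnote 3 / Rusin–Šverák 2011, §1 p. 3, here for the Leray–Hopf class). If `u` is a
Leray–Hopf weak solution on `E × [0, T)` with viscosity `ν`, force `f` and datum `u₀`, then for
every `c > 0` the field `s ↦ c u(c s)` is a Leray–Hopf weak solution on `[0, T/c)` with viscosity
`c ν`, force `s ↦ c² f(c s)` and datum `c u₀`: the weak formulation is
`IsWeakNSSolutionOn.viscosityRescale`; the weak gradient rescales to `s ↦ c G(c s)`; both sides of
each energy inequality pick up the factor `c²` (`energyIneq_timeRescale`); the `L^∞L²` bound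
picks up `c²`; weak and strong `L²` continuity are composed with `s ↦ c s`.
[cite: Tao2011, footnote 3] -/
theorem IsLerayHopfOn.viscosityRescale {T ν : ℝ} {f u : ℝ → E → E} {u₀ : E → E}
    (h : IsLerayHopfOn T ν f u₀ u) {c : ℝ} (hc : 0 < c) :
    IsLerayHopfOn (T / c) (c * ν) (timeRescale c (c ^ 2) f) (c • u₀) (timeRescale c c u) := by
  have hmap := tendsto_mul_left_nhdsGT_zero hc
  refine
    { weak := h.weak.viscosityRescale hc
      energy_bound := ?_
      memLp := fun s hs => ?_
      weakGrad_energy := ?_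
      weak_continuous := fun w hw => ?_
      strong_initial := ?_ }
  · -- `L^∞(0, T/c; L²)`
    obtain ⟨C, hC⟩ := h.energy_bound
    refine ⟨Real.toNNReal (c ^ 2) * C, ?_⟩
    filter_upwards [ae_restrict_Ioo_div_comp_mul_left hc T hC] with s hs
    show ∫⁻ x, ‖c • u (c * s) x‖ₑ ^ 2 ≤ _
    rw [lintegral_enorm_sq_const_smul, ENNReal.coe_mul]
    exact mul_le_mul' le_rfl hs
  · -- every slice is in `L²`
    rw [timeRescale_slice]
    exact (h.memLp (c * s) (mul_mem_Icc_zero_of_mem_Icc_div hc hs)).const_smul c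
  · -- weak gradient `s ↦ c G(c s)` and the two energy inequalities
    obtain ⟨G, hG, hGint, h0, hae⟩ := h.weakGrad_energy
    refine ⟨timeRescale c c G, ?_, ?_, fun s hs => ?_, ?_⟩
    · filter_upwards [ae_restrict_Ioo_div_comp_mul_left hc T hG] with s hs
      rw [timeRescale_slice, timeRescale_slice]
      exact hs.const_smul c
    · rw [setLIntegral_frobeniusNormSq_timeRescale hc, mul_zero, mul_div_cancel_pos hc]
      exact ENNReal.mul_lt_top (ENNReal.mul_lt_top ENNReal.ofReal_lt_top ENNReal.ofReal_lt_top)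
        hGint
    · have h1 := h0 (c * s) (mul_mem_Icc_zero_of_mem_Icc_div hc hs)
      have h2 := energyIneq_timeRescale (a := 0) (A := VectorCalculus.kineticEnergy u₀) hc
        (f := f) (u := u) (G := G) (ν := ν) (b := s) (by rwa [mul_zero])
      rwa [← kineticEnergy_const_smul] at h2
    · have hae' : ∀ᵐ σ ∂(volume.restrict (Ioo 0 T)), ∀ t ∈ Icc σ T,
          VectorCalculus.kineticEnergy (u t) +
            ν * (∫⁻ τ in Ioo σ t, ∫⁻ x, ENNReal.ofReal (frobeniusNormSq (G τ x))).toReal ≤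
          VectorCalculus.kineticEnergy (u σ) + ∫ τ in σ..t, ∫ x, ⟪f τ x, u τ x⟫ := hae
      filter_upwards [ae_restrict_Ioo_div_comp_mul_left hc T hae'] with s hs t hst
      have hct : c * t ∈ Icc (c * s) T :=
        ⟨mul_le_mul_of_nonneg_left hst.1 hc.le, by rw [mul_comm]; exact (le_div_iff₀ hc).1 hst.2⟩
      have h2 := energyIneq_timeRescale (a := s) (A := VectorCalculus.kineticEnergy (u (c * s))) hc
        (f := f) (u := u) (G := G) (ν := ν) (b := t) (hs (c * t) hct)
      rwa [← kineticEnergy_const_smul, ← timeRescale_slice] at h2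
  · -- weak `L²` continuity on `(0, T/c]` and the weak initial limit
    obtain ⟨hcont, hlim⟩ := h.weak_continuous w hw
    have e : (fun s => ∫ x, ⟪timeRescale c c u s x, w x⟫) =
        fun s => c * ((fun t => ∫ x, ⟪u t x, w x⟫) (c * s)) := by
      funext s
      simp only [timeRescale_apply, real_inner_smul_left, integral_const_mul]
    rw [e]
    refine ⟨continuousOn_const.mul
      (hcont.comp (continuous_const_mul c).continuousOn (mapsTo_mul_Ioc_div hc T)), ?_⟩
    have h3 := (hlim.comp hmap).const_mul c
    have e0 : ∫ x, ⟪(c • u₀) x, w x⟫ = c * ∫ x, ⟪u₀ x, w x⟫ := by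
      simp only [Pi.smul_apply, real_inner_smul_left, integral_const_mul]
    rw [e0]
    exact h3
  · -- the datum `c u₀` is attained strongly in `L²`
    have e : (fun s => eLpNorm (timeRescale c c u s - c • u₀) 2 volume) =
        fun s => ‖c‖ₑ * ((fun t => eLpNorm (u t - u₀) 2 volume) (c * s)) := by
      funext s
      have hsub : timeRescale c c u s - c • u₀ = c • (u (c * s) - u₀) := by
        funext x; simp [timeRescale_apply, smul_sub]
      rw [hsub, eLpNorm_const_smul]
    rw [e, ← mul_zero (‖c‖ₑ)]
    exact ENNReal.Tendsto.const_mul (h.strong_initial.comp hmap) (Or.inr enorm_ne_top)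

end Scaling

/-! ### Albritton–Brué–Colombo at unit viscosity (faithful rendering), and the reduction of ns.S20 to it -/

section ABC

/-- **Albritton–Brué–Colombo non-uniqueness at unit viscosity, as printed** (Ann. of Math. 196
(2022) = arXiv:2112.03116, Thm. 1.2 "Non-uniqueness", for the system (NS)
`∂ₜu + u·∇u − Δu + ∇p = f`, `div u = 0`, i.e. `ν = 1`; Def. 1.1 for the solution class): *there
exist `T > 0`, `f ∈ L¹_t L²_x(ℝ³ × (0, T))`, and two distinct suitable Leray–Hopf solutions `u`,
`ū` on `ℝ³ × (0, T)` with body force `f` and initial condition `u₀ ≡ 0`.* Rendering: the force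
is **jointly (a.e.-strongly) measurable on `(0, T) × ℝ³`** and lies in the slice-wise mixed class
`MemLqLp 1 2 f (Ioo 0 T)` — together the tree's reading of Def. 1.1's Bochner class
`L¹_t L²_x(ℝ³ × (0,T))` (an `L¹_t L²_x` field has a jointly measurable representative, and a
jointly measurable field with `∫₀ᵀ ‖f t‖₂ dt < ∞` defines an element of `L¹(0,T; L²)`); the
measurability clause is the one `IsWeakNSSolutionOn` imposes on the velocity and
`hopf_existence_torus` on its force, and it is what makes the force terms
`∫₀ᵀ ∫ ⟪f, ψ⟫`, `∫ₛᵗ ∫ ⟪f, u⟫` of `IsWeakNSSolutionOn` / `IsLerayHopfOn` honest Bochner integrals.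
The two solutions are Leray–Hopf in the strict sense of the accepted `IsLerayHopfOn T 1 f 0`
(energy inequality also from a.e. `s`, strong attainment of the datum, weak `L²` continuity on
`(0, T]`) — the printed Def. 1.1 asks less, but the solutions of Thm. 1.3 (refined form: `ū`
self-similar with smooth compactly supported profile, `u = ū + u^{lin} + u^{per}`) are smooth for
`t > 0`, satisfy the energy inequality with equality and the bounds (1.13) `‖u(t)‖₂ ≲ t^{1/4}`,
hence are Leray–Hopf in the strict sense (and suitable, which is not recorded: the rendering is
weaker than print in this respect only); "distinct" is rendered by `u(t) ≠ ū(t)` on a set of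
positive measure for some `t ∈ (0, T)`. *Restated 2026-08-15 (statement strengthened):* the
first rendering lacked the measurability clause and was provable by a degenerate non-measurable
force (`ABCVacuity.unit_rendering_is_vacuous`, `NSLerayHopfABCVacuity.lean`; module docstring,
"Restatement"). The every-viscosity tree fact `albritton_brue_colombo` (no measurability clause)
follows (`albritton_brue_colombo_of_unit`); the faithful every-viscosity form is
`albritton_brue_colombo_unit_iff_forall_viscosity`. Undecomposed root fact: the proof is Thm. 1.3
(§2 Vishik's unstable vortex and its vortex-ring lift, §3 spectral perturbation, §4 Thm. 4.1
nonlinear instability); `albritton_brue_colombo_unit_of_similarityProfiles`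
(`NSLerayHopfABCAssembly.lean`) proves this statement from Thm. 1.3-type profile data.
[cite: AlbrittonBrueColombo2022, Thm. 1.2 (Non-uniqueness) with Def. 1.1 and Thm. 1.3; arXiv:2112.03116] -/
def albritton_brue_colombo_unit : Prop :=
  ∃ T : ℝ, 0 < T ∧ ∃ f : ℝ → EuclideanSpace ℝ (Fin 3) → EuclideanSpace ℝ (Fin 3),
    AEStronglyMeasurable (uncurry f) (volume.restrict (Ioo 0 T ×ˢ univ)) ∧
    MemLqLp 1 2 f (Ioo 0 T) ∧
    ∃ u v : ℝ → EuclideanSpace ℝ (Fin 3) → EuclideanSpace ℝ (Fin 3),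
      IsLerayHopfOn T 1 f 0 u ∧ IsLerayHopfOn T 1 f 0 v ∧ ∃ t ∈ Ioo 0 T, ¬ (u t =ᵐ[volume] v t)

/-- **ns.S20 from any single viscosity**: if the non-uniqueness statement holds at one viscosity
`ν₀ > 0` in the rendering of `albritton_brue_colombo` (two Leray–Hopf solutions on `ℝ³ × [0, T)`
with zero datum and a common force in the slice-wise class `L¹_t L²_x`, distinct at a positive
time), then it holds at every `ν > 0`: rescale by `c = ν / ν₀` (`IsLerayHopfOn.viscosityRescale`,
`MemLqLp.viscosityRescale`). [cite: Tao2011, footnote 3] -/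
theorem albritton_brue_colombo_of_viscosity {ν₀ : ℝ} (hν₀ : 0 < ν₀)
    (h : ∃ T : ℝ, 0 < T ∧ ∃ f : ℝ → EuclideanSpace ℝ (Fin 3) → EuclideanSpace ℝ (Fin 3),
        MemLqLp 1 2 f (Ioo 0 T) ∧
        ∃ u v : ℝ → EuclideanSpace ℝ (Fin 3) → EuclideanSpace ℝ (Fin 3),
          IsLerayHopfOn T ν₀ f 0 u ∧ IsLerayHopfOn T ν₀ f 0 v ∧
            ∃ t ∈ Ioo 0 T, ¬ (u t =ᵐ[volume] v t)) :
    albritton_brue_colombo := by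
  intro ν hν
  obtain ⟨T, hT, f, hf, u, v, hu, hv, t, ht, hne⟩ := h
  have hc : 0 < ν / ν₀ := div_pos hν hν₀
  have hu' := hu.viscosityRescale hc
  have hv' := hv.viscosityRescale hc
  rw [div_mul_cancel₀ _ hν₀.ne', smul_zero] at hu' hv'
  refine ⟨T / (ν / ν₀), div_pos hT hc, timeRescale (ν / ν₀) ((ν / ν₀) ^ 2) f,
    hf.viscosityRescale hc _, timeRescale (ν / ν₀) (ν / ν₀) u, timeRescale (ν / ν₀) (ν / ν₀) v,
    hu', hv', t / (ν / ν₀), ⟨div_pos ht.1 hc, div_lt_div_of_pos_right ht.2 hc⟩, fun heq => hne ?_⟩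
  filter_upwards [heq] with x hx
  rw [timeRescale_apply, timeRescale_apply, mul_div_cancel_pos hc] at hx
  exact smul_right_injective _ hc.ne' hx

/-- **ns.S20 for every viscosity from the printed unit-viscosity theorem** ("the general case
follows by the Navier–Stokes scaling", docstring of `albritton_brue_colombo`; the viscosity is
normalised as in Tao 2013, footnote 3): forget the measurability of the force and rescale the
unit-viscosity pair `(u, ū)` on `(0, T)` with force `f` to the pair `ν u(ν ·)`, `ν ū(ν ·)` on
`(0, T/ν)` with force `ν² f(ν ·)` and zero datum (`albritton_brue_colombo_of_viscosity` at
`ν₀ = 1`). The converse is not available: `albritton_brue_colombo` carries no measurability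
clause on its force (see `albritton_brue_colombo_unit_iff_forall_viscosity` for the faithful
every-viscosity form). [cite: AlbrittonBrueColombo2022, Thm. 1.2 (Non-uniqueness); arXiv:2112.03116] -/
theorem albritton_brue_colombo_of_unit (h : albritton_brue_colombo_unit) :
    albritton_brue_colombo := by
  obtain ⟨T, hT, f, -, hf, u, v, hu, hv, ht⟩ := h
  exact albritton_brue_colombo_of_viscosity one_pos ⟨T, hT, f, hf, u, v, hu, hv, ht⟩

/-- **The faithful unit-viscosity theorem is equivalent to its every-viscosity form** ("the
general case follows by the Navier–Stokes scaling"): `albritton_brue_colombo_unit` holds iff for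
every `ν > 0` there are `T > 0`, a force jointly measurable on `(0, T) × ℝ³` and in
`L¹(0, T; L²)`, and two Leray–Hopf solutions with viscosity `ν` from `u₀ = 0` distinct at a time
in `(0, T)` (`→`: rescale by `c = ν` — `IsLerayHopfOn.viscosityRescale`,
`MemLqLp.viscosityRescale`, and the transport of joint measurability along the time dilation
`(s, x) ↦ (ν s, x)`, `aestronglyMeasurable_comp_stAffine_Ioo`; `←`: `ν = 1`). The right-hand
side is the statement that `albritton_brue_colombo` (`NSLerayHopf.lean`) renders WITHOUT the
measurability clause; this equivalence replaces the withdrawn `albritton_brue_colombo_iff_unit`.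
[cite: AlbrittonBrueColombo2022, Thm. 1.2 (Non-uniqueness) with Def. 1.1; arXiv:2112.03116] [cite: Tao2011, footnote 3] -/
theorem albritton_brue_colombo_unit_iff_forall_viscosity :
    albritton_brue_colombo_unit ↔
      ∀ ν : ℝ, 0 < ν →
        ∃ T : ℝ, 0 < T ∧ ∃ f : ℝ → EuclideanSpace ℝ (Fin 3) → EuclideanSpace ℝ (Fin 3),
          AEStronglyMeasurable (uncurry f) (volume.restrict (Ioo 0 T ×ˢ univ)) ∧
          MemLqLp 1 2 f (Ioo 0 T) ∧
          ∃ u v : ℝ → EuclideanSpace ℝ (Fin 3) → EuclideanSpace ℝ (Fin 3),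
            IsLerayHopfOn T ν f 0 u ∧ IsLerayHopfOn T ν f 0 v ∧
              ∃ t ∈ Ioo 0 T, ¬ (u t =ᵐ[volume] v t) := by
  refine ⟨fun h ν hν => ?_, fun h => h 1 one_pos⟩
  obtain ⟨T, hT, f, hfm, hf, u, v, hu, hv, t, ht, hne⟩ := h
  have hu' := hu.viscosityRescale hν
  have hv' := hv.viscosityRescale hν
  rw [mul_one, smul_zero] at hu' hv'
  -- joint measurability of the rescaled force `ν² f(ν ·, ·)` on `(0, T/ν) × ℝ³`
  have hfm' : AEStronglyMeasurable (uncurry (timeRescale ν (ν ^ 2) f))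
      (volume.restrict (Ioo 0 (T / ν) ×ˢ univ)) := by
    have h1 := aestronglyMeasurable_comp_stAffine_Ioo hν one_pos (0 : EuclideanSpace ℝ (Fin 3)) hfm
    have h2 : uncurry (timeRescale ν (ν ^ 2) f) =
        fun z => (ν ^ 2) • (uncurry f ∘ stAffine ν 1 0 (0 : EuclideanSpace ℝ (Fin 3))) z := by
      funext z
      obtain ⟨s, y⟩ := z
      simp [stAffine]
    rw [h2]
    exact h1.const_smul (ν ^ 2)
  refine ⟨T / ν, div_pos hT hν, timeRescale ν (ν ^ 2) f, hfm', hf.viscosityRescale hν _,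
    timeRescale ν ν u, timeRescale ν ν v, hu', hv', t / ν,
    ⟨div_pos ht.1 hν, div_lt_div_of_pos_right ht.2 hν⟩, fun heq => hne ?_⟩
  filter_upwards [heq] with x hx
  rw [timeRescale_apply, timeRescale_apply, mul_div_cancel_pos hν] at hx
  exact smul_right_injective _ hν.ne' hx

end ABC

end Literature.Analysis.FluidPDE

end
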